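import Literature.Computability.AlgebraicComplexity.LaserValueProducts
import Literature.Computability.AlgebraicComplexity.RectangularExponentAlpha
import HarnessLib

/-!
# The format value of a tensor (Coppersmith 1997 §3; Le Gall 2012 §3; Le Gall 2014 Def. 2.1 / Thm. 2.2, rectangular form) — definition and proved closure properties

Topic `Literature/Computability/AlgebraicComplexity`.  The tree types the SQUARE value-method
completely: `HasLaserValue ρ t v` ("`V_ρ(t) ≥ v`", `LaserValue.lean`), its algebra
(`LaserValueProducts.lean`), Le Gall's Theorem 4.1 (`LaserMethodValues.laserMethod_hasLaserValue`) and
the applications `ω < 2.376` (`CW_q^{⊗2}`) and `ω ≤ 2.37295` (`CW_q^{⊗4}`).  Its measure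
`∑ᵢ (kᵢ mᵢ nᵢ)^{ρ/3}` forgets the SHAPE of the blocks, so it cannot bound a rectangular exponent
`ω(1,k,1)`.  The rectangular analyses of the Coppersmith–Winograd powers (Coppersmith 1997 §3,
`α > 0.294`; Huang–Pan 1998 §3; Le Gall 2012 §3, `α > 0.302`) run the same
recursion in FORMAT currency: a component is "worth `v^N` independent matrix products of format
`(A^N, B^N, C^N)`".  This file vendors that notion as a lower-bound predicate with explicit witnesses,
exactly parallel to `HasLaserValue`:

  `HasFormatValue t v A B C` :⇔ for every `ε > 0` some power `t^{⊗N}` (`N ≥ 1`) degenerates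
  (`PolyDegeneratesTo`) into `p` independent copies of ONE matrix tensor, `⟨p⟩ ⊗ ⟨X, Y, Z⟩`, with
  `v^N ≤ (1+ε)^N p` and `A^N ≤ X`, `B^N ≤ Y`, `C^N ≤ Z`.

The count `v` and the three format parameters are multiplicative, which is what the laser method
consumes (the blocks of a free diagonal of one joint type are isomorphic, so uniform blocks suffice).
Proved here, mirroring `LaserValue(Products).lean` lemma by lemma (the degeneration halves of the
proofs are the tree's relabelling lemmas; only the numeric halves change):

* `hasFormatValue_of_witness`, `hasFormatValue_multiple_matMulTensor`, `hasFormatValue_matMulTensor`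
  (`⟨X,Y,Z⟩` is worth one product of format `(X,Y,Z)`), `hasFormatValue_of_nonpos`;
* `HasFormatValue.mono`, `.of_polyDegeneratesTo`, `.of_restrictsTo`;
* `HasFormatValue.multiple` (`⟨e⟩ ⊗ t`: count `e v`), `.kronecker` (counts and formats multiply),
  `.kroneckerPi`, `.kroneckerPow`, `.of_kroneckerPow` (`n`-th roots), `hasFormatValue_of_forall_lt`
  (closure in the count);
* **`mul_rpow_omegaRect_le_asymptoticRank_of_hasFormatValue`** — the rectangular form of Le Gall's
  Thm. 2.2 (Schönhage's asymptotic sum inequality): if `HasFormatValue t v A B A` with `1 < A`,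
  `0 ≤ k`, `A^k ≤ B`, then **`v · A^{ω(1,k,1)} ≤ R̃(t)`** (asymptotic rank).  Proof: power the witness
  until `A^{NM} ≥ 2`, shrink the blocks to `⟨a, Y^M, a⟩` with `a = ⌊A^{NM}⌋ ≥ A^{NM}/2`, apply
  `mul_rpow_omegaRect_mid_le_asymptoticRank` (`SchonhageRectangular.lean`) and
  `R̃(t^{⊗NM}) ≤ R̃(t)^{NM}`, and let `M → ∞`, `ε → 0`;
* `omegaRect_one_mid_one_le_of_hasFormatValue` — the reading `ω(1,k,1) ≤ log(R/v)/log A` for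
  `R̃(t) ≤ R`, `v > 0`.

This is the value algebra of the rectangular laser method ("layer T" of the `MatrixMultiplication`
route `SaturationLadder`, whose level-1 theorem `SaturationLadderLevelOne.omegaRect_cwSix_le` is the
matrix-component special case `v ≡ 1`); the method itself (Le Gall Thm. 4.1 in format currency) and
the `CW_q^{⊗2}` rectangular application are separate files.

Library fit (searched: `HasLaserValue`, `degenerationValue`, `omegaRect`, `mul_rpow_omegaRect`,
`matMulDirectSum`, `Format`): no rectangular/format-aware value predicate exists in the tree; the
two small relabelling lemmas `restrictsTo_kronecker_assoc`, `restrictsTo_matMulTensor_shrink` restate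
`RectangularExponentCertTransfer.tensorRestrictsTo_kronecker_assoc` and
`RectangularBarrier.tensorRestrictsTo_matMulTensor_of_le`, which are not in this file's import
closure (kept local to keep the closure at `LaserValueProducts` + `RectangularExponentAlpha`).

Everything is proved; one definition (`HasFormatValue`), no named facts.

## References

* D. Coppersmith, *Rectangular matrix multiplication revisited*, J. Complexity 13 (1997), §3. [Coppersmith1997]
* X. Huang, V. Y. Pan, *Fast rectangular matrix multiplication and applications*, J. Complexity 14
  (1998), §3. [HuangPan1998]
* F. Le Gall, *Faster algorithms for rectangular matrix multiplication*, FOCS 2012, arXiv:1204.1111,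
  §3. [LeGall2012]
* F. Le Gall, *Powers of tensors and fast matrix multiplication*, ISSAC 2014, arXiv:1401.7714, §2.2,
  Thm. 2.2. [LeGall2014]
* M. Bläser, *Fast Matrix Multiplication*, Theory of Computing Graduate Surveys 5 (2013), §5, §7,
  §9.4. [Blaser2013]
* J. Alman, R. Duan, V. Vassilevska Williams, Y. Xu, Z. Xu, R. Zhou, SODA 2025, Thm. 3.2.
  [AlmanDuanVassilevskaWilliamsXuXuZhou2025]
-/

noncomputable section

open scoped BigOperators
open Finset Filter Topology

namespace Literature.Computability.AlgebraicComplexity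

open Literature.Barriers.MatrixMultiplication

universe u

/-! ## The definition -/

section Defs

variable {K : Type u} [Field K]
variable {ι κ μ : Type*} [Fintype ι] [Fintype κ] [Fintype μ]

/-- **Format value `≥ (v; A, B, C)`**: for every `ε > 0` some power `t^{⊗N}` (`N ≥ 1`) degenerates
into `p` independent copies of one matrix tensor `⟨X,Y,Z⟩` with `v^N ≤ (1+ε)^N · p` and
`A^N ≤ X`, `B^N ≤ Y`, `C^N ≤ Z` — the rectangular (shape-remembering) analogue of
`HasLaserValue` (Coppersmith–Winograd's value counts `∑ (kmn)^{ρ/3}` instead).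
[cite: LeGall2012, §3] [cite: Coppersmith1997, §3] [cite: LeGall2014, Def. 2.1] -/
def HasFormatValue (t : ι → κ → μ → K) (v A B C : ℝ) : Prop :=
  ∀ ε : ℝ, 0 < ε → ∃ N : ℕ, 1 ≤ N ∧ ∃ (p X Y Z : ℕ),
    PolyDegeneratesTo (kroneckerPow t N) (kroneckerTensor (unitTensor K p) (matMulTensor K X Y Z)) ∧
      v ^ N ≤ (1 + ε) ^ N * p ∧ A ^ N ≤ X ∧ B ^ N ≤ Y ∧ C ^ N ≤ Z

end Defs

/-! ## Relabelling lemmas (the few the tree lacks in this exact shape) -/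

section Relabel

variable {K : Type u} [Field K]
variable {ι κ μ ι₁ κ₁ μ₁ ι₂ κ₂ μ₂ : Type*} [Fintype ι] [Fintype κ] [Fintype μ] [Fintype ι₁]
  [Fintype κ₁] [Fintype μ₁] [Fintype ι₂] [Fintype κ₂] [Fintype μ₂] [DecidableEq ι] [DecidableEq κ]
  [DecidableEq μ] [DecidableEq ι₁] [DecidableEq κ₁] [DecidableEq μ₁] [DecidableEq ι₂] [DecidableEq κ₂]
  [DecidableEq μ₂]

/-- `s ⊗ (x ⊗ y) ≥ (s ⊗ x) ⊗ y` (relabelling along `Equiv.prodAssoc`; the tree's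
`tensorRestrictsTo_kronecker_assoc` of `RectangularExponentCertTransfer.lean`, restated to keep this
file's import closure small). [folklore] -/
private theorem restrictsTo_kronecker_assoc (s : ι → κ → μ → K) (x : ι₁ → κ₁ → μ₁ → K)
    (y : ι₂ → κ₂ → μ₂ → K) :
    TensorRestrictsTo (kroneckerTensor s (kroneckerTensor x y))
      (kroneckerTensor (kroneckerTensor s x) y) := by
  have key : kroneckerTensor (kroneckerTensor s x) y = fun a b c =>
      kroneckerTensor s (kroneckerTensor x y) (Equiv.prodAssoc _ _ _ a) (Equiv.prodAssoc _ _ _ b)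
        (Equiv.prodAssoc _ _ _ c) := by
    funext a b c
    simp only [kroneckerTensor_apply, Equiv.prodAssoc_apply]
    ring
  rw [key]
  exact tensorRestrictsTo_precomp _ _ _ _

/-- `s ≥ ⟨1⟩ ⊗ s` (`⟨1⟩` is the scalar `1`; relabelling along the second projections). [folklore] -/
private theorem restrictsTo_unit_one_kronecker (s : ι → κ → μ → K) :
    TensorRestrictsTo s (kroneckerTensor (unitTensor K 1) s) := by
  have key : kroneckerTensor (unitTensor K 1) s = fun a b c => s a.2 b.2 c.2 := by
    funext a b c
    rw [kroneckerTensor_apply, unitTensor_one, one_mul]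
  rw [key]
  exact tensorRestrictsTo_precomp _ _ _ _

variable (K) in
/-- **Zero-padding**: `⟨X,Y,Z⟩ ≥ ⟨X',Y',Z'⟩` for `X' ≤ X`, `Y' ≤ Y`, `Z' ≤ Z` (restriction along the
coordinate embeddings `Fin.castLE`; Bläser 2013, Lemma 5.4; the Barriers file `RectangularBarrier.lean`
has it as `tensorRestrictsTo_matMulTensor_of_le`, outside this file's imports). [cite: Blaser2013, Lemma 5.4] -/
theorem restrictsTo_matMulTensor_shrink {X X' Y Y' Z Z' : ℕ} (hX : X' ≤ X) (hY : Y' ≤ Y)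
    (hZ : Z' ≤ Z) : TensorRestrictsTo (matMulTensor K X Y Z) (matMulTensor K X' Y' Z') := by
  have e : matMulTensor K X' Y' Z' = fun a b c => matMulTensor K X Y Z
      (Prod.map (Fin.castLE hX) (Fin.castLE hZ) a) (Prod.map (Fin.castLE hX) (Fin.castLE hY) b)
      (Prod.map (Fin.castLE hY) (Fin.castLE hZ) c) := by
    funext a b c
    simp [matMulTensor, Prod.map, Fin.ext_iff]
  rw [e]
  exact tensorRestrictsTo_precomp _ _ _ _

omit [DecidableEq ι] [DecidableEq κ] [DecidableEq μ] in
/-- Every tensor restricts to the empty direct sum `⟨0⟩ ⊗ ⟨X,Y,Z⟩` (empty index types). [folklore] -/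
private theorem restrictsTo_unit_zero_kronecker (s : ι → κ → μ → K) (X Y Z : ℕ) :
    TensorRestrictsTo s (kroneckerTensor (unitTensor K 0) (matMulTensor K X Y Z)) :=
  ⟨fun a _ => Fin.elim0 a.1, fun b _ => Fin.elim0 b.1, fun c _ => Fin.elim0 c.1,
    fun a => Fin.elim0 a.1⟩

end Relabel

/-! ## Witnesses, monotonicity, matrix tensors -/

section Basic

variable {K : Type u} [Field K]
variable {ι κ μ ι' κ' μ' : Type*} [Fintype ι] [Fintype κ] [Fintype μ] [Fintype ι'] [Fintype κ']
  [Fintype μ'] [DecidableEq ι] [DecidableEq κ] [DecidableEq μ] [DecidableEq ι'] [DecidableEq κ']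
  [DecidableEq μ']

/-- `N`-th roots of naturals, powered back. [folklore] -/
private theorem rpow_inv_natCast_pow (x : ℕ) {N : ℕ} (hN : 1 ≤ N) :
    (((x : ℝ) ^ ((N : ℝ)⁻¹)) ^ N : ℝ) = x := by
  have hN0 : (N : ℝ) ≠ 0 := by exact_mod_cast (by omega : N ≠ 0)
  rw [← Real.rpow_natCast, ← Real.rpow_mul (Nat.cast_nonneg x), inv_mul_cancel₀ hN0, Real.rpow_one]

omit [DecidableEq ι] [DecidableEq κ] [DecidableEq μ] in
/-- **One witness gives a format value**: if `t^{⊗N} ⊵ ⟨p⟩ ⊗ ⟨X,Y,Z⟩` then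
`HasFormatValue t p^{1/N} X^{1/N} Y^{1/N} Z^{1/N}`. [cite: Blaser2013, §9.4] -/
theorem hasFormatValue_of_witness {t : ι → κ → μ → K} {N : ℕ} (hN : 1 ≤ N) {p X Y Z : ℕ}
    (h : PolyDegeneratesTo (kroneckerPow t N)
      (kroneckerTensor (unitTensor K p) (matMulTensor K X Y Z))) :
    HasFormatValue t ((p : ℝ) ^ ((N : ℝ)⁻¹)) ((X : ℝ) ^ ((N : ℝ)⁻¹)) ((Y : ℝ) ^ ((N : ℝ)⁻¹))
      ((Z : ℝ) ^ ((N : ℝ)⁻¹)) := by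
  intro ε hε
  refine ⟨N, hN, p, X, Y, Z, h, ?_, ?_, ?_, ?_⟩
  · rw [rpow_inv_natCast_pow p hN]
    have h1 : (1 : ℝ) ≤ (1 + ε) ^ N := one_le_pow₀ (by linarith)
    nlinarith [Nat.cast_nonneg (α := ℝ) p]
  · rw [rpow_inv_natCast_pow X hN]
  · rw [rpow_inv_natCast_pow Y hN]
  · rw [rpow_inv_natCast_pow Z hN]

omit [DecidableEq ι] [DecidableEq κ] [DecidableEq μ] in
/-- Monotonicity in all four parameters (towards smaller nonnegative ones) — the format reading of
"`V_ρ(t) ≥ v ≥ v'` ⇒ `V_ρ(t) ≥ v'`". [cite: LeGall2014, §2.2] -/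
theorem HasFormatValue.mono {t : ι → κ → μ → K} {v A B C v' A' B' C' : ℝ}
    (h : HasFormatValue t v A B C) (hv' : 0 ≤ v') (hvv' : v' ≤ v) (hA' : 0 ≤ A') (hAA' : A' ≤ A)
    (hB' : 0 ≤ B') (hBB' : B' ≤ B) (hC' : 0 ≤ C') (hCC' : C' ≤ C) :
    HasFormatValue t v' A' B' C' := by
  intro ε hε
  obtain ⟨N, hN, p, X, Y, Z, hdeg, hv, hA, hB, hC⟩ := h ε hε
  exact ⟨N, hN, p, X, Y, Z, hdeg, (pow_le_pow_left₀ hv' hvv' N).trans hv,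
    (pow_le_pow_left₀ hA' hAA' N).trans hA, (pow_le_pow_left₀ hB' hBB' N).trans hB,
    (pow_le_pow_left₀ hC' hCC' N).trans hC⟩

/-- **Monotone under degeneration**: `t ⊵ t'` and `HasFormatValue t' …` give `HasFormatValue t …`.
[cite: LeGall2014, §2.2] -/
theorem HasFormatValue.of_polyDegeneratesTo {t : ι → κ → μ → K} {t' : ι' → κ' → μ' → K}
    {v A B C : ℝ} (htt' : PolyDegeneratesTo t t') (h : HasFormatValue t' v A B C) :
    HasFormatValue t v A B C := by
  intro ε hε
  obtain ⟨N, hN, p, X, Y, Z, hdeg, hb⟩ := h ε hε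
  exact ⟨N, hN, p, X, Y, Z, (PolyDegeneratesTo.kroneckerPow htt' N).trans hdeg, hb⟩

/-- In particular monotone under restriction. [cite: LeGall2014, §2.2] -/
theorem HasFormatValue.of_restrictsTo {t : ι → κ → μ → K} {t' : ι' → κ' → μ' → K}
    {v A B C : ℝ} (htt' : TensorRestrictsTo t t') (h : HasFormatValue t' v A B C) :
    HasFormatValue t v A B C :=
  h.of_polyDegeneratesTo htt'.polyDegeneratesTo

variable (K) in
/-- **`⟨p⟩ ⊗ ⟨X,Y,Z⟩` is worth `p` products of format `(X,Y,Z)`** ("if `⊕ᵢ ⟨kᵢ,mᵢ,nᵢ⟩ ⊴ t^{⊗N}`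
then the value of `t` is at least …", one witness at `N = 1`). [cite: Blaser2013, §9.4] -/
theorem hasFormatValue_multiple_matMulTensor (p X Y Z : ℕ) :
    HasFormatValue (kroneckerTensor (unitTensor K p) (matMulTensor K X Y Z)) p X Y Z := by
  intro ε hε
  refine ⟨1, le_rfl, p, X, Y, Z, (tensorRestrictsTo_kroneckerPow_one _).polyDegeneratesTo, ?_,
    by rw [pow_one], by rw [pow_one], by rw [pow_one]⟩
  rw [pow_one, pow_one]
  nlinarith [Nat.cast_nonneg (α := ℝ) p]

variable (K) in
/-- **`⟨X,Y,Z⟩` is worth one product of format `(X,Y,Z)`** (the rectangular reading of Le Gall's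
"`V_ρ(⟨m,n,p⟩) ≥ (mnp)^{ρ/3}`"). [cite: LeGall2014, §2.2] -/
theorem hasFormatValue_matMulTensor (X Y Z : ℕ) :
    HasFormatValue (matMulTensor K X Y Z) 1 X Y Z := by
  have h := (hasFormatValue_multiple_matMulTensor K 1 X Y Z).of_restrictsTo
    (restrictsTo_unit_one_kronecker (matMulTensor K X Y Z))
  simpa using h

/-- The count `≤ 0` is free, for any formats: the empty direct sum (zero blocks) is a witness at
`N = 1` (the value set always contains the empty sum). [cite: Blaser2013, §9.4] -/
theorem hasFormatValue_of_nonpos (t : ι → κ → μ → K) {v : ℝ} (hv : v ≤ 0) (A B C : ℝ) :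
    HasFormatValue t v A B C := by
  intro ε hε
  refine ⟨1, le_rfl, 0, ⌈A⌉₊, ⌈B⌉₊, ⌈C⌉₊,
    ((tensorRestrictsTo_kroneckerPow_one t).trans
      (restrictsTo_unit_zero_kronecker t _ _ _)).polyDegeneratesTo, ?_, ?_, ?_, ?_⟩
  · simpa using hv
  · rw [pow_one]; exact Nat.le_ceil A
  · rw [pow_one]; exact Nat.le_ceil B
  · rw [pow_one]; exact Nat.le_ceil C

end Basic

/-! ## Multiples and products: counts and formats multiply -/

section Products

variable {K : Type u} [Field K]
variable {ι κ μ ι' κ' μ' : Type*} [Fintype ι] [Fintype κ] [Fintype μ] [Fintype ι'] [Fintype κ']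
  [Fintype μ'] [DecidableEq ι] [DecidableEq κ] [DecidableEq μ] [DecidableEq ι'] [DecidableEq κ']
  [DecidableEq μ']

/-- **`⟨e⟩ ⊗ t` is worth `e` times the count of `t`, same formats** (superadditivity for copies).
[cite: LeGall2014, §2.2] -/
theorem HasFormatValue.multiple {t : ι → κ → μ → K} {v A B C : ℝ} (h : HasFormatValue t v A B C)
    (e : ℕ) : HasFormatValue (kroneckerTensor (unitTensor K e) t) (e * v) A B C := by
  classical
  intro ε hε
  obtain ⟨N, hN, p, X, Y, Z, hdeg, hv, hA, hB, hC⟩ := h ε hε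
  refine ⟨N, hN, e ^ N * p, X, Y, Z, ?_, ?_, hA, hB, hC⟩
  · -- `(⟨e⟩⊗t)^{⊗N} ≥ ⟨e^N⟩ ⊗ t^{⊗N} ⊵ ⟨e^N⟩ ⊗ (⟨p⟩ ⊗ ⟨X,Y,Z⟩) ≥ (⟨e^N⟩⊗⟨p⟩) ⊗ ⟨X,Y,Z⟩ ≥ ⟨e^N p⟩ ⊗ ⟨X,Y,Z⟩`
    refine ((tensorRestrictsTo_kroneckerPow_unit_kronecker e t N).polyDegeneratesTo.trans
      ((TensorRestrictsTo.refl (unitTensor K (e ^ N))).polyDegeneratesTo.kronecker hdeg)).trans ?_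
    exact ((restrictsTo_kronecker_assoc _ _ _).trans
      ((tensorRestrictsTo_unitTensor_mul K (e ^ N) p).kronecker (TensorRestrictsTo.refl _))).polyDegeneratesTo
  · push_cast
    rw [mul_pow, mul_left_comm]
    exact mul_le_mul_of_nonneg_left hv (by positivity)

/-- **Supermultiplicativity**: `HasFormatValue t v A B C`, `HasFormatValue t' v' A' B' C'` (all
parameters `≥ 0`) give `HasFormatValue (t ⊗ t') (v v') (A A') (B B') (C C')`.  Witnesses at powers
`N`, `N'` are brought to the common power `N N'` (`(⟨p⟩⊗⟨X,Y,Z⟩)^{⊗N'} ≥ ⟨p^{N'}⟩⊗⟨X^{N'},Y^{N'},Z^{N'}⟩`)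
and multiplied (`(⟨p⟩⊗M) ⊗ (⟨p'⟩⊗M') ≥ ⟨pp'⟩ ⊗ (M M')`). [cite: LeGall2014, §2.2] [cite: Blaser2013, §7] -/
theorem HasFormatValue.kronecker {t : ι → κ → μ → K} {t' : ι' → κ' → μ' → K}
    {v A B C v' A' B' C' : ℝ} (h : HasFormatValue t v A B C) (h' : HasFormatValue t' v' A' B' C')
    (hv : 0 ≤ v) (hv' : 0 ≤ v') (hA : 0 ≤ A) (hA' : 0 ≤ A') (hB : 0 ≤ B) (hB' : 0 ≤ B')
    (hC : 0 ≤ C) (hC' : 0 ≤ C') :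
    HasFormatValue (kroneckerTensor t t') (v * v') (A * A') (B * B') (C * C') := by
  classical
  intro ε hε
  obtain ⟨η, hη, -, hηε⟩ := exists_pos_mul_self_le_one_add hε
  obtain ⟨N, hN, p, X, Y, Z, hdeg, hb, hbA, hbB, hbC⟩ := h η hη
  obtain ⟨N', hN', p', X', Y', Z', hdeg', hb', hbA', hbB', hbC'⟩ := h' η hη
  refine ⟨N * N', Nat.one_le_iff_ne_zero.2 (Nat.mul_ne_zero (by omega) (by omega)),
    p ^ N' * p' ^ N, X ^ N' * X' ^ N, Y ^ N' * Y' ^ N, Z ^ N' * Z' ^ N, ?_, ?_, ?_, ?_, ?_⟩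
  · -- degenerations at the common power
    have ht : PolyDegeneratesTo (kroneckerPow t (N * N'))
        (kroneckerTensor (unitTensor K (p ^ N')) (matMulTensor K (X ^ N') (Y ^ N') (Z ^ N'))) := by
      have h1 : TensorRestrictsTo (kroneckerPow t (N * N')) (kroneckerPow (kroneckerPow t N) N') :=
        (tensorRestrictsTo_kroneckerPow_of_eq t (Nat.mul_comm N N')).trans
          (tensorRestrictsTo_kroneckerPow_mul t N' N)
      exact (h1.trans_polyDegeneratesTo (hdeg.kroneckerPow N')).trans_restrictsTo
        (tensorRestrictsTo_kroneckerPow_multiple_matMulTensor K p X Y Z N')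
    have ht' : PolyDegeneratesTo (kroneckerPow t' (N * N'))
        (kroneckerTensor (unitTensor K (p' ^ N)) (matMulTensor K (X' ^ N) (Y' ^ N) (Z' ^ N))) :=
      ((tensorRestrictsTo_kroneckerPow_mul t' N N').trans_polyDegeneratesTo
        (hdeg'.kroneckerPow N)).trans_restrictsTo
          (tensorRestrictsTo_kroneckerPow_multiple_matMulTensor K p' X' Y' Z' N)
    exact ((tensorRestrictsTo_kroneckerPow_of_kronecker t t' (N * N')).trans_polyDegeneratesTo
      (ht.kronecker ht')).trans_restrictsTo
        (tensorRestrictsTo_kronecker_multiple_matMulTensor K _ _ _ _ _ _ _ _)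
  · -- the count
    have h1 : (v ^ N) ^ N' ≤ ((1 + η) ^ N * p) ^ N' := pow_le_pow_left₀ (pow_nonneg hv N) hb N'
    have h2 : (v' ^ N') ^ N ≤ ((1 + η) ^ N' * p') ^ N := pow_le_pow_left₀ (pow_nonneg hv' N') hb' N
    have h3 : ((1 + η) * (1 + η)) ^ (N * N') ≤ (1 + ε) ^ (N * N') :=
      pow_le_pow_left₀ (by positivity) hηε _
    push_cast
    calc (v * v') ^ (N * N') = (v ^ N) ^ N' * (v' ^ N') ^ N := by
          rw [mul_pow, ← pow_mul, ← pow_mul, Nat.mul_comm N' N]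
      _ ≤ ((1 + η) ^ N * p) ^ N' * ((1 + η) ^ N' * p') ^ N :=
          mul_le_mul h1 h2 (pow_nonneg (pow_nonneg hv' N') N) (by positivity)
      _ = ((1 + η) * (1 + η)) ^ (N * N') * ((p : ℝ) ^ N' * (p' : ℝ) ^ N) := by
          rw [mul_pow, mul_pow, mul_pow, ← pow_mul, ← pow_mul, Nat.mul_comm N' N]; ring
      _ ≤ (1 + ε) ^ (N * N') * ((p : ℝ) ^ N' * (p' : ℝ) ^ N) :=
          mul_le_mul_of_nonneg_right h3 (by positivity)
  · push_cast
    calc (A * A') ^ (N * N') = (A ^ N) ^ N' * (A' ^ N') ^ N := by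
          rw [mul_pow, ← pow_mul, ← pow_mul, Nat.mul_comm N' N]
      _ ≤ (X : ℝ) ^ N' * (X' : ℝ) ^ N :=
          mul_le_mul (pow_le_pow_left₀ (pow_nonneg hA N) hbA N')
            (pow_le_pow_left₀ (pow_nonneg hA' N') hbA' N) (pow_nonneg (pow_nonneg hA' N') N)
            (by positivity)
  · push_cast
    calc (B * B') ^ (N * N') = (B ^ N) ^ N' * (B' ^ N') ^ N := by
          rw [mul_pow, ← pow_mul, ← pow_mul, Nat.mul_comm N' N]
      _ ≤ (Y : ℝ) ^ N' * (Y' : ℝ) ^ N :=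
          mul_le_mul (pow_le_pow_left₀ (pow_nonneg hB N) hbB N')
            (pow_le_pow_left₀ (pow_nonneg hB' N') hbB' N) (pow_nonneg (pow_nonneg hB' N') N)
            (by positivity)
  · push_cast
    calc (C * C') ^ (N * N') = (C ^ N) ^ N' * (C' ^ N') ^ N := by
          rw [mul_pow, ← pow_mul, ← pow_mul, Nat.mul_comm N' N]
      _ ≤ (Z : ℝ) ^ N' * (Z' : ℝ) ^ N :=
          mul_le_mul (pow_le_pow_left₀ (pow_nonneg hC N) hbC N')
            (pow_le_pow_left₀ (pow_nonneg hC' N') hbC' N) (pow_nonneg (pow_nonneg hC' N') N)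
            (by positivity)

/-- **`N`-th roots**: `HasFormatValue (t^{⊗n}) w A B C` (`n ≥ 1`, parameters `≥ 0`) gives
`HasFormatValue t w^{1/n} A^{1/n} B^{1/n} C^{1/n}` (a witness for `(t^{⊗n})^{⊗N}` is one for `t^{⊗nN}`).
[cite: LeGall2014, §2.2] -/
theorem HasFormatValue.of_kroneckerPow {t : ι → κ → μ → K} {w A B C : ℝ} {n : ℕ} (hn : 1 ≤ n)
    (h : HasFormatValue (kroneckerPow t n) w A B C) (hw : 0 ≤ w) (hA : 0 ≤ A) (hB : 0 ≤ B)
    (hC : 0 ≤ C) :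
    HasFormatValue t (w ^ ((n : ℝ)⁻¹)) (A ^ ((n : ℝ)⁻¹)) (B ^ ((n : ℝ)⁻¹)) (C ^ ((n : ℝ)⁻¹)) := by
  classical
  intro ε hε
  obtain ⟨N, hN, p, X, Y, Z, hdeg, hb, hbA, hbB, hbC⟩ := h ε hε
  refine ⟨N * n, Nat.one_le_iff_ne_zero.2 (Nat.mul_ne_zero (by omega) (by omega)), p, X, Y, Z,
    (tensorRestrictsTo_kroneckerPow_mul t N n).trans_polyDegeneratesTo hdeg, ?_, ?_, ?_, ?_⟩
  all_goals
    have hn0 : (n : ℝ) ≠ 0 := by exact_mod_cast (by omega : n ≠ 0)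
  · have h1 : (w ^ ((n : ℝ)⁻¹)) ^ (N * n) = w ^ N := by
      rw [Nat.mul_comm, pow_mul, ← Real.rpow_natCast (w ^ ((n : ℝ)⁻¹)) n, ← Real.rpow_mul hw,
        inv_mul_cancel₀ hn0, Real.rpow_one]
    rw [h1]
    refine hb.trans (mul_le_mul_of_nonneg_right ?_ (Nat.cast_nonneg _))
    exact pow_le_pow_right₀ (by linarith) (Nat.le_mul_of_pos_right N (by omega))
  · have h1 : (A ^ ((n : ℝ)⁻¹)) ^ (N * n) = A ^ N := by
      rw [Nat.mul_comm, pow_mul, ← Real.rpow_natCast (A ^ ((n : ℝ)⁻¹)) n, ← Real.rpow_mul hA,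
        inv_mul_cancel₀ hn0, Real.rpow_one]
    rw [h1]; exact hbA
  · have h1 : (B ^ ((n : ℝ)⁻¹)) ^ (N * n) = B ^ N := by
      rw [Nat.mul_comm, pow_mul, ← Real.rpow_natCast (B ^ ((n : ℝ)⁻¹)) n, ← Real.rpow_mul hB,
        inv_mul_cancel₀ hn0, Real.rpow_one]
    rw [h1]; exact hbB
  · have h1 : (C ^ ((n : ℝ)⁻¹)) ^ (N * n) = C ^ N := by
      rw [Nat.mul_comm, pow_mul, ← Real.rpow_natCast (C ^ ((n : ℝ)⁻¹)) n, ← Real.rpow_mul hC,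
        inv_mul_cancel₀ hn0, Real.rpow_one]
    rw [h1]; exact hbC

/-- The empty Kronecker product (a family indexed by `Fin 0`) is the scalar `1 ≅ ⟨1⟩ ⊗ ⟨1,1,1⟩`:
worth one product of format `(1,1,1)` ("`V_ρ(⟨1,1,1⟩) ≥ 1`"). [cite: LeGall2014, §2.2] -/
theorem hasFormatValue_kroneckerPi_zero (T : Fin 0 → ι → κ → μ → K) :
    HasFormatValue (kroneckerPi T) 1 1 1 1 := by
  classical
  have hdeg : PolyDegeneratesTo (kroneckerPow (kroneckerPi T) 1)
      (kroneckerTensor (unitTensor K 1) (matMulTensor K 1 1 1)) := by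
    refine TensorRestrictsTo.polyDegeneratesTo ?_
    have key : kroneckerTensor (unitTensor K 1) (matMulTensor K 1 1 1) = fun a b c =>
        kroneckerPow (kroneckerPi T) 1 (fun _ i => Fin.elim0 i) (fun _ i => Fin.elim0 i)
          (fun _ i => Fin.elim0 i) := by
      funext a b c
      have hr : kroneckerPow (kroneckerPi T) 1 (fun _ i => Fin.elim0 i) (fun _ i => Fin.elim0 i)
          (fun _ i => Fin.elim0 i) = 1 := by
        simp [kroneckerPow_apply, kroneckerPi_apply]
      obtain ⟨a₁, a₂, a₃⟩ := a
      obtain ⟨b₁, b₂, b₃⟩ := b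
      obtain ⟨c₁, c₂, c₃⟩ := c
      have e₁ := Fin.fin_one_eq_zero a₂
      have e₂ := Fin.fin_one_eq_zero a₃
      have e₃ := Fin.fin_one_eq_zero b₂
      have e₄ := Fin.fin_one_eq_zero b₃
      have e₅ := Fin.fin_one_eq_zero c₂
      have e₆ := Fin.fin_one_eq_zero c₃
      subst e₁ e₂ e₃ e₄ e₅ e₆
      rw [hr, kroneckerTensor_apply, unitTensor_one, one_mul]
      simp [matMulTensor]
    rw [key]
    exact tensorRestrictsTo_precomp _ _ _ _
  have h := hasFormatValue_of_witness (le_refl 1) hdeg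
  simpa using h

/-- **`N`-ary supermultiplicativity** over a family `T : Fin N → _` (the shape in which the laser
method values a block `⊗_ρ t(w ρ)` of `t^{⊗N}`). [cite: LeGall2014, §2.2 and proof of Thm. 4.1] -/
theorem HasFormatValue.kroneckerPi {N : ℕ} {T : Fin N → ι → κ → μ → K} {v A B C : Fin N → ℝ}
    (h : ∀ l, HasFormatValue (T l) (v l) (A l) (B l) (C l)) (hv : ∀ l, 0 ≤ v l)
    (hA : ∀ l, 0 ≤ A l) (hB : ∀ l, 0 ≤ B l) (hC : ∀ l, 0 ≤ C l) :
    HasFormatValue (kroneckerPi T) (∏ l, v l) (∏ l, A l) (∏ l, B l) (∏ l, C l) := by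
  induction N with
  | zero =>
    simp only [Finset.univ_eq_empty, Finset.prod_empty]
    exact hasFormatValue_kroneckerPi_zero T
  | succ N ih =>
    rw [Fin.prod_univ_succ, Fin.prod_univ_succ, Fin.prod_univ_succ, Fin.prod_univ_succ]
    have ih' : HasFormatValue (Literature.Computability.AlgebraicComplexity.kroneckerPi fun l => T l.succ)
        (∏ l : Fin N, v l.succ) (∏ l : Fin N, A l.succ) (∏ l : Fin N, B l.succ)
        (∏ l : Fin N, C l.succ) :=
      ih (fun l => h l.succ) (fun l => hv l.succ) (fun l => hA l.succ) (fun l => hB l.succ)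
        (fun l => hC l.succ)
    exact ((h 0).kronecker ih' (hv 0) (Finset.prod_nonneg fun l _ => hv l.succ) (hA 0)
      (Finset.prod_nonneg fun l _ => hA l.succ) (hB 0) (Finset.prod_nonneg fun l _ => hB l.succ)
      (hC 0) (Finset.prod_nonneg fun l _ => hC l.succ)).of_restrictsTo
      (tensorRestrictsTo_kroneckerPi_succ T)

/-- **Powers**: `HasFormatValue t v A B C` (parameters `≥ 0`) gives
`HasFormatValue (t^{⊗n}) (v^n) (A^n) (B^n) (C^n)`. [cite: LeGall2014, §2.2] -/
theorem HasFormatValue.kroneckerPow {t : ι → κ → μ → K} {v A B C : ℝ} (h : HasFormatValue t v A B C)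
    (hv : 0 ≤ v) (hA : 0 ≤ A) (hB : 0 ≤ B) (hC : 0 ≤ C) (n : ℕ) :
    HasFormatValue (kroneckerPow t n) (v ^ n) (A ^ n) (B ^ n) (C ^ n) := by
  have h1 := HasFormatValue.kroneckerPi (N := n) (T := fun _ => t) (v := fun _ => v)
    (A := fun _ => A) (B := fun _ => B) (C := fun _ => C) (fun _ => h) (fun _ => hv) (fun _ => hA)
    (fun _ => hB) (fun _ => hC)
  simp only [Finset.prod_const, Finset.card_univ, Fintype.card_fin] at h1
  rwa [← kroneckerPow_eq_kroneckerPi] at h1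

end Products

/-! ## Closure in the count -/

section Limits

variable {K : Type u} [Field K]
variable {ι κ μ : Type*} [Fintype ι] [Fintype κ] [Fintype μ] [DecidableEq ι] [DecidableEq κ]
  [DecidableEq μ]

/-- **Closure from below in the count**: if `HasFormatValue t v' A B C` for all `0 ≤ v' < v` then
`HasFormatValue t v A B C` (use `v/(1+η)` at tolerance `η`, `(1+η)² ≤ 1+ε`; the value is a limit,
Le Gall Def. 2.1). [cite: LeGall2014, Def. 2.1] -/
theorem hasFormatValue_of_forall_lt {t : ι → κ → μ → K} {v A B C : ℝ}
    (h : ∀ v' : ℝ, 0 ≤ v' → v' < v → HasFormatValue t v' A B C) : HasFormatValue t v A B C := by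
  rcases le_or_gt v 0 with hv | hv
  · exact hasFormatValue_of_nonpos t hv A B C
  · intro ε hε
    obtain ⟨η, hη, -, hηε⟩ := exists_pos_mul_self_le_one_add hε
    have hη1 : (0 : ℝ) < 1 + η := by linarith
    have hv' : v / (1 + η) < v := by
      rw [div_lt_iff₀ hη1]; nlinarith
    obtain ⟨N, hN, p, X, Y, Z, hdeg, hb, hbA, hbB, hbC⟩ :=
      h (v / (1 + η)) (div_nonneg hv.le hη1.le) hv' η hη
    refine ⟨N, hN, p, X, Y, Z, hdeg, ?_, hbA, hbB, hbC⟩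
    have h1 : v ^ N = (1 + η) ^ N * (v / (1 + η)) ^ N := by
      rw [← mul_pow, mul_div_cancel₀ _ hη1.ne']
    calc v ^ N = (1 + η) ^ N * (v / (1 + η)) ^ N := h1
      _ ≤ (1 + η) ^ N * ((1 + η) ^ N * p) := mul_le_mul_of_nonneg_left hb (by positivity)
      _ = ((1 + η) * (1 + η)) ^ N * p := by rw [mul_pow]; ring
      _ ≤ (1 + ε) ^ N * p :=
          mul_le_mul_of_nonneg_right (pow_le_pow_left₀ (by positivity) hηε N) (Nat.cast_nonneg _)

end Limits

/-! ## From format values to rectangular exponents (Le Gall Thm. 2.2 / Schönhage, rectangular) -/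

section Omega

/-- If `y ≥ 0` and `x^n ≤ C · y^n` for all large `n`, then `x ≤ y`. [folklore] -/
private theorem le_of_forall_pow_le_mul {x y C : ℝ} (hy : 0 ≤ y) {N₀ : ℕ}
    (h : ∀ n : ℕ, N₀ ≤ n → x ^ n ≤ C * y ^ n) : x ≤ y := by
  by_contra hlt
  rw [not_le] at hlt
  rcases hy.eq_or_lt with hy0 | hy0
  · -- `y = 0`: `x^n ≤ 0` for some `n ≥ 1`
    have h1 := h (N₀ + 1) (by omega)
    rw [← hy0, zero_pow (by omega), mul_zero] at h1
    have h2 : 0 < x ^ (N₀ + 1) := pow_pos (by linarith) _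
    linarith
  · -- `y > 0`: `(x/y)^n → ∞`
    have hr : 1 < x / y := by rw [lt_div_iff₀ hy0]; linarith
    have hev : ∀ᶠ n : ℕ in atTop, C < (x / y) ^ n :=
      (tendsto_pow_atTop_atTop_of_one_lt hr).eventually_gt_atTop C
    obtain ⟨n, hn₀, hn⟩ := (hev.and (eventually_ge_atTop N₀)).exists
    have h1 := h n hn
    rw [div_pow, lt_div_iff₀ (pow_pos hy0 n)] at hn₀
    linarith

variable {K : Type} [Field K]
variable {ι κ μ : Type} [Fintype ι] [Fintype κ] [Fintype μ] [DecidableEq ι] [DecidableEq κ]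
  [DecidableEq μ]

/-- **Format values bound rectangular exponents** (the rectangular Le Gall Thm. 2.2): if
`HasFormatValue t v A B A` with `1 < A`, `0 ≤ k` and `A^k ≤ B`, then `v · A^{ω(1,k,1)} ≤ R̃(t)`.
For every `ε` and every large `M` the witness gives `t^{⊗NM} ⊵ ⟨p^M⟩ ⊗ ⟨X^M, Y^M, Z^M⟩ ≥
⟨p^M⟩ ⊗ ⟨a, Y^M, a⟩` with `a = ⌊A^{NM}⌋ ≥ 2`, `a^k ≤ Y^M`, so Schönhage's rectangular asymptotic sum
inequality (`mul_rpow_omegaRect_mid_le_asymptoticRank`) and `R̃(t^{⊗NM}) ≤ R̃(t)^{NM}` give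
`p^M a^{ω(1,k,1)} ≤ R̃(t)^{NM}`; with `a ≥ A^{NM}/2` and `v^{NM} ≤ (1+ε)^{NM} p^M` this is
`(v A^{ω(1,k,1)})^{NM} ≤ 2^{ω(1,k,1)} ((1+ε) R̃(t))^{NM}` for all large `M`.
[cite: LeGall2012, Thm. 2.1] [cite: LeGall2014, Thm. 2.2]
[cite: AlmanDuanVassilevskaWilliamsXuXuZhou2025, Thm. 3.2] -/
theorem mul_rpow_omegaRect_le_asymptoticRank_of_hasFormatValue {t : ι → κ → μ → K}
    {v A B k : ℝ} (h : HasFormatValue t v A B A) (hA : 1 < A) (hk : 0 ≤ k)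
    (hAB : A ^ k ≤ B) : v * A ^ omegaRect K 1 k 1 ≤ asymptoticRank t := by
  classical
  set ω₀ : ℝ := omegaRect K 1 k 1 with hω₀
  have hω0 : 0 ≤ ω₀ := by have := two_le_omegaRect_one_mid_one K k; linarith
  have hR0 : 0 ≤ asymptoticRank t := asymptoticRank_nonneg t
  have hA0 : 0 < A := by linarith
  have hAω : 0 < A ^ ω₀ := Real.rpow_pos_of_pos hA0 _
  rcases le_or_gt v 0 with hv | hv
  · exact (mul_nonpos_of_nonpos_of_nonneg hv hAω.le).trans hR0
  -- `v A^{ω₀} ≤ (1+ε) R̃(t)` for every `ε > 0`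
  have key : ∀ ε : ℝ, 0 < ε → v * A ^ ω₀ ≤ (1 + ε) * asymptoticRank t := by
    intro ε hε
    obtain ⟨N, hN, p, X, Y, Z, hdeg, hb, hbA, hbB, hbC⟩ := h ε hε
    -- `p ≥ 1`
    have hp : 1 ≤ p := by
      rcases Nat.eq_zero_or_pos p with hp0 | hp0
      · rw [hp0, Nat.cast_zero, mul_zero] at hb
        have := pow_pos hv N; linarith
      · exact hp0
    -- a power `M₀` with `A^{M₀} ≥ 2`
    obtain ⟨M₀, hM₀⟩ : ∃ M₀ : ℕ, (2 : ℝ) ≤ A ^ M₀ := by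
      obtain ⟨M₀, hM₀⟩ := pow_unbounded_of_one_lt (2 : ℝ) hA
      exact ⟨M₀, hM₀.le⟩
    refine le_of_forall_pow_le_mul (x := v * A ^ ω₀) (y := (1 + ε) * asymptoticRank t)
      (C := (2 : ℝ) ^ ω₀) (by positivity) (N₀ := N * (M₀ + 1)) fun n hn => ?_
    -- the bound at the witness powers `N M`, `M > M₀`; the bound at a general exponent `n` is
    -- deduced below from the one at `N n`
    have main : ∀ M : ℕ, M₀ + 1 ≤ M →
        (v * A ^ ω₀) ^ (N * M) ≤ (2 : ℝ) ^ ω₀ * ((1 + ε) * asymptoticRank t) ^ (N * M) := by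
      intro M hM
      -- the powered witness
      have hdegM : PolyDegeneratesTo (kroneckerPow t (N * M))
          (kroneckerTensor (unitTensor K (p ^ M)) (matMulTensor K (X ^ M) (Y ^ M) (Z ^ M))) := by
        have h1 : TensorRestrictsTo (kroneckerPow t (N * M)) (kroneckerPow (kroneckerPow t N) M) :=
          (tensorRestrictsTo_kroneckerPow_of_eq t (Nat.mul_comm N M)).trans
            (tensorRestrictsTo_kroneckerPow_mul t M N)
        exact (h1.trans_polyDegeneratesTo (hdeg.kroneckerPow M)).trans_restrictsTo
          (tensorRestrictsTo_kroneckerPow_multiple_matMulTensor K p X Y Z M)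
      -- `a = ⌊A^{NM}⌋`
      set a : ℕ := ⌊A ^ (N * M)⌋₊ with ha
      have hANM2 : (2 : ℝ) ≤ A ^ (N * M) := by
        calc (2 : ℝ) ≤ A ^ M₀ := hM₀
          _ ≤ A ^ (N * M) := pow_le_pow_right₀ hA.le (by nlinarith)
      have hApos : 0 ≤ A ^ (N * M) := by positivity
      have ha_le : (a : ℝ) ≤ A ^ (N * M) := Nat.floor_le hApos
      have ha_ge : A ^ (N * M) - 1 ≤ a := by
        have := Nat.lt_floor_add_one (A ^ (N * M)); linarith
      have ha2 : 2 ≤ a := by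
        have h3 : (2 : ℝ) ≤ ⌊A ^ (N * M)⌋₊ := by
          have := Nat.floor_le_floor hANM2
          have h2 : ⌊(2 : ℝ)⌋₊ = 2 := by norm_num
          rw [h2] at this; exact_mod_cast this
        exact_mod_cast h3
      have ha_half : A ^ (N * M) / 2 ≤ a := by linarith
      -- `a ≤ X^M`, `a ≤ Z^M`, `a^k ≤ Y^M`
      have haX : a ≤ X ^ M := by
        have h1 : (a : ℝ) ≤ (X : ℝ) ^ M := ha_le.trans (by
          rw [pow_mul]; exact pow_le_pow_left₀ (pow_nonneg hA0.le N) hbA M)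
        exact_mod_cast h1
      have haZ : a ≤ Z ^ M := by
        have h1 : (a : ℝ) ≤ (Z : ℝ) ^ M := ha_le.trans (by
          rw [pow_mul]; exact pow_le_pow_left₀ (pow_nonneg hA0.le N) hbC M)
        exact_mod_cast h1
      have haY : (a : ℝ) ^ k ≤ ((Y ^ M : ℕ) : ℝ) := by
        push_cast
        calc (a : ℝ) ^ k ≤ (A ^ (N * M)) ^ k := Real.rpow_le_rpow (Nat.cast_nonneg _) ha_le hk
          _ = (A ^ k) ^ (N * M) := by
              rw [← Real.rpow_natCast, ← Real.rpow_mul hA0.le, mul_comm, Real.rpow_mul hA0.le,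
                Real.rpow_natCast]
          _ ≤ B ^ (N * M) := pow_le_pow_left₀ (Real.rpow_nonneg hA0.le k) hAB _
          _ = (B ^ N) ^ M := pow_mul B N M
          _ ≤ (Y : ℝ) ^ M :=
              pow_le_pow_left₀ (pow_nonneg (le_trans (Real.rpow_nonneg hA0.le k) hAB) N) hbB M
      -- Schönhage, rectangular, and monotonicity of `R̃`
      have hS := mul_rpow_omegaRect_mid_le_asymptoticRank K hk (t := p ^ M) (a := a) (B := Y ^ M)
        (one_le_pow₀ hp) ha2 haY
      have hshrink : TensorRestrictsTo
          (kroneckerTensor (unitTensor K (p ^ M)) (matMulTensor K (X ^ M) (Y ^ M) (Z ^ M)))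
          (kroneckerTensor (unitTensor K (p ^ M)) (matMulTensor K a (Y ^ M) a)) :=
        (TensorRestrictsTo.refl _).kronecker (restrictsTo_matMulTensor_shrink K haX le_rfl haZ)
      have hmono : asymptoticRank (kroneckerTensor (unitTensor K (p ^ M)) (matMulTensor K a (Y ^ M) a))
          ≤ asymptoticRank t ^ (N * M) :=
        (asymptoticRank_le_of_polyDegeneratesTo (hdegM.trans_restrictsTo hshrink)).trans
          (asymptoticRank_kroneckerPow_le t (Nat.mul_pos (by omega) (by omega)))
      -- `p^M a^{ω₀} ≤ R̃(t)^{NM}`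
      have hchain : ((p : ℝ) ^ M) * (a : ℝ) ^ ω₀ ≤ asymptoticRank t ^ (N * M) := by
        have := hS.trans hmono; push_cast at this; exact this
      -- assemble
      have hvNM : v ^ (N * M) ≤ (1 + ε) ^ (N * M) * (p : ℝ) ^ M := by
        calc v ^ (N * M) = (v ^ N) ^ M := pow_mul v N M
          _ ≤ ((1 + ε) ^ N * p) ^ M := pow_le_pow_left₀ (pow_nonneg hv.le N) hb M
          _ = (1 + ε) ^ (N * M) * (p : ℝ) ^ M := by rw [mul_pow, ← pow_mul]
      have haω : (A ^ (N * M) / 2) ^ ω₀ ≤ (a : ℝ) ^ ω₀ :=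
        Real.rpow_le_rpow (by positivity) ha_half hω0
      have hsplit : (2 : ℝ) ^ ω₀ * (A ^ (N * M) / 2) ^ ω₀ = (A ^ ω₀) ^ (N * M) := by
        rw [← Real.mul_rpow zero_le_two (by positivity),
          show (2 : ℝ) * (A ^ (N * M) / 2) = A ^ (N * M) by ring,
          ← Real.rpow_natCast (A ^ ω₀) (N * M), ← Real.rpow_mul hA0.le,
          mul_comm ω₀ ((N * M : ℕ) : ℝ), Real.rpow_mul hA0.le, Real.rpow_natCast]
      have h2ω : 0 ≤ (2 : ℝ) ^ ω₀ := (Real.rpow_pos_of_pos two_pos _).le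
      calc (v * A ^ ω₀) ^ (N * M) = v ^ (N * M) * (A ^ ω₀) ^ (N * M) := mul_pow _ _ _
        _ ≤ ((1 + ε) ^ (N * M) * (p : ℝ) ^ M) * (A ^ ω₀) ^ (N * M) :=
            mul_le_mul_of_nonneg_right hvNM (by positivity)
        _ = (2 : ℝ) ^ ω₀ * ((1 + ε) ^ (N * M) * ((p : ℝ) ^ M * (A ^ (N * M) / 2) ^ ω₀)) := by
            rw [← hsplit]; ring
        _ ≤ (2 : ℝ) ^ ω₀ * ((1 + ε) ^ (N * M) * ((p : ℝ) ^ M * (a : ℝ) ^ ω₀)) :=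
            mul_le_mul_of_nonneg_left (mul_le_mul_of_nonneg_left
              (mul_le_mul_of_nonneg_left haω (by positivity)) (by positivity)) h2ω
        _ ≤ (2 : ℝ) ^ ω₀ * ((1 + ε) ^ (N * M) * asymptoticRank t ^ (N * M)) :=
            mul_le_mul_of_nonneg_left (mul_le_mul_of_nonneg_left hchain (by positivity)) h2ω
        _ = (2 : ℝ) ^ ω₀ * ((1 + ε) * asymptoticRank t) ^ (N * M) := by rw [mul_pow]
    -- from exponents `N M` to the exponent `n`: use `M = n` (`N n ≥ n`) and `x ≤ y ∨ y < x`
    rcases le_or_gt (v * A ^ ω₀) ((1 + ε) * asymptoticRank t) with hle | hgt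
    · exact (pow_le_pow_left₀ (by positivity) hle n).trans
        (le_mul_of_one_le_left (by positivity) (Real.one_le_rpow one_le_two hω0))
    · -- if `x > y` then `x^n ≤ x^{Nn} / y^{Nn} · y^n`-type bounds: from `main` at `M = n`,
      -- `x^{N n} ≤ 2^{ω₀} y^{N n}` and `x > y ≥ 0` give `x^n ≤ 2^{ω₀} y^n` as well, since
      -- `(x/y)^n ≤ (x/y)^{Nn}` when `x/y > 1` (and `y = 0` is impossible: `x^{Nn} ≤ 0`).
      have hn' : M₀ + 1 ≤ n := le_trans (Nat.le_mul_of_pos_left _ (by omega)) hn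
      have hm := main n hn'
      set x := v * A ^ ω₀
      set y := (1 + ε) * asymptoticRank t
      have hx0 : 0 < x := by positivity
      have hy0 : 0 ≤ y := by positivity
      rcases hy0.eq_or_lt with hy00 | hy00
      · rw [← hy00, zero_pow (Nat.mul_ne_zero (by omega) (by omega)), mul_zero] at hm
        have := pow_pos hx0 (N * n); linarith
      · have hxy : 1 ≤ x / y := by rw [le_div_iff₀ hy00]; linarith
        have h1 : (x / y) ^ n ≤ (x / y) ^ (N * n) :=
          pow_le_pow_right₀ hxy (Nat.le_mul_of_pos_left n (by omega))
        have h2 : (x / y) ^ (N * n) ≤ (2 : ℝ) ^ ω₀ := by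
          rw [div_pow, div_le_iff₀ (pow_pos hy00 _)]; exact hm
        have h3 : (x / y) ^ n ≤ (2 : ℝ) ^ ω₀ := h1.trans h2
        rw [div_pow, div_le_iff₀ (pow_pos hy00 _)] at h3
        exact h3
  -- `ε → 0`
  have : v * A ^ ω₀ ≤ asymptoticRank t := by
    refine le_of_forall_pos_lt_add fun η hη => ?_
    have h1 := key (η / (2 * (asymptoticRank t + 1))) (by positivity)
    have h2 : η / (2 * (asymptoticRank t + 1)) * asymptoticRank t < η := by
      rw [div_mul_eq_mul_div, div_lt_iff₀ (by positivity)]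
      nlinarith
    nlinarith
  exact this

/-- **Corollary (the ladder's reading)**: `HasFormatValue t v A (A^k) A`-type data with `R̃(t) ≤ R`,
`0 < v` bound the rectangular exponent: `ω(1,k,1) ≤ log (R / v) / log A` (Le Gall 2012, Thm. 2.1
with `R̲(F_q) ≤ q + 2`, §3). [cite: LeGall2012, Thm. 2.1] -/
theorem omegaRect_one_mid_one_le_of_hasFormatValue {t : ι → κ → μ → K} {v A B k R : ℝ}
    (h : HasFormatValue t v A B A) (hA : 1 < A) (hk : 0 ≤ k) (hAB : A ^ k ≤ B) (hv : 0 < v)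
    (hR : asymptoticRank t ≤ R) :
    omegaRect K 1 k 1 ≤ Real.log (R / v) / Real.log A := by
  have hmain := (mul_rpow_omegaRect_le_asymptoticRank_of_hasFormatValue h hA hk hAB).trans hR
  have hA0 : 0 < A := by linarith
  have hlogA : 0 < Real.log A := Real.log_pos hA
  rw [le_div_iff₀ hlogA, ← Real.log_rpow hA0]
  have hAω : 0 < A ^ omegaRect K 1 k 1 := Real.rpow_pos_of_pos hA0 _
  have h1 : A ^ omegaRect K 1 k 1 ≤ R / v := by
    rw [le_div_iff₀ hv, mul_comm]; exact hmain
  exact Real.log_le_log hAω h1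

end Omega

end Literature.Computability.AlgebraicComplexity

end
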